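import Literature.AlgebraicGeometry.Motives.CartierDivisorLineBundleSectionsOn
import Literature.AlgebraicGeometry.Motives.CartierDivisorCocycle
import HarnessLib

/-!
# An isomorphism `𝒪_Y(D) ≅ 𝒪_Y` of the glued line bundle is multiplication by a rational function
# (Görtz–Wedhorn I, (11.9) / Prop. 11.21: `𝒪_Y(D) ≅ 𝒪_Y` iff `D` is principal)

Layer `Literature/AlgebraicGeometry/Motives`, namespace `Literature.AlgebraicGeometry.Motives.CartierDivisor` (dot notation on `D`).
THEOREMS ONLY (no definition, no named fact, no instance, no `sorry`).

For a Cartier divisor `D = (U_i, f_i)` on an integral scheme `Y` the tree's ★ `CartierDivisorLineBundleSectionsOn` reads the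
sections of the glued line bundle `Modules.lineBundle D.toUnitCocycle` (★ `Modules/LineBundleOfCocycle`) as rational functions
(`D.lineBundleRatFn hW s ∈ K(Y)`, the subsheaf `𝒪_Y(D) ⊆ 𝒦_Y` of [GortzWedhorn2020] (11.9)).  This file reads an ISOMORPHISM
`e : Modules.lineBundle D.toUnitCocycle ≅ 𝒪_Y` (Mathlib `SheafOfModules.unit`) in the same currency: there is a rational function
`h ≠ 0` — the image of the local generator `t_ξ` times `f_{i(ξ)}` — such that

* `e(s) = φ(s) · h` in `K(Y)` for EVERY section `s` over EVERY non-empty open `W`, and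
* `h / f_i` is a unit on `U_i` — both clauses of `exists_ratFn_of_iso_unit` (with `isUnit_hom_app_lineBundleGen`,
  `hom_app_eq_comp_mul` as lemmas) —, i.e. `D = div(h⁻¹)`-type principality: `h⁻¹` is a «trivializer»
  of `D` in the sense of ★ `AbelianVariety.IsTrivializer` when `D = [n]^*E` ([GortzWedhorn2020] Prop. 11.21: `𝒪_Y(D) ≅ 𝒪_Y`
  iff `D` is principal).

Consumer: cell hodgecm-mathlib (h9-S) (W2-iii) — the character pairing of ★ `TorsionSectionPairing` read on a trivialisation
`[n]^*𝒪(D_Q) ≅ [n]^*𝒪` IS the Kummer constant `g_Q∘t_P / g_Q` of ★ `AbelianVarietyWeilPairingLevel` (which accepts ANY trivializer,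
★ `weilPairingLevel_eq_kummerConst`).  Count-neutral; HC_CM is proved only modulo the 7 printed citations until rung 0 closes.

## References
* [GortzWedhorn2020] U. Görtz, T. Wedhorn, *Algebraic Geometry I*, 2nd ed. (2020), (11.9) pp. 373–374, Prop. 11.21 (p. 374),
  Prop. 3.29 (2) (p. 102).
-/

noncomputable section

open CategoryTheory AlgebraicGeometry Opposite TopologicalSpace

namespace Literature.AlgebraicGeometry.Motives.CartierDivisor

open RatFn Literature.AlgebraicGeometry.Modules

universe u

variable {Y : Scheme.{u}} [IsIntegral Y] (D : CartierDivisor Y)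
  (e : Modules.lineBundle D.toUnitCocycle ≅ SheafOfModules.unit Y.ringCatSheaf)

/-! ### §1 Images of generators are units; the image of a section in the chart of a point -/

omit [IsIntegral Y] in
/-- Naturality of a morphism of modules with respect to restriction, on elements. [cite: GortzWedhorn2020, Section (7.1)] -/
private theorem app_presheaf_map' {M N : Y.Modules} (ψ : M ⟶ N) {U W : Y.Opens} (i : U ⟶ W) (y : Γ(M, W)) :
    ψ.app U (M.presheaf.map i.op y) = N.presheaf.map i.op (ψ.app W y) :=
  ConcreteCategory.congr_hom (ψ.mapPresheaf.naturality i.op) y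

/-- `ofSection` of `1` is `1`. [cite: GortzWedhorn2020, Prop. 3.29 (2) (p. 102)] -/
private theorem ofSection_one' {U : Y.Opens} (hU : genericPoint Y ∈ U) : ofSection hU (1 : Γ(Y, U)) = 1 :=
  map_one (Y.presheaf.germ U (genericPoint Y) hU).hom

/-- **An isomorphism onto `𝒪_Y` maps the local generator `t_z` (over `V ≤ U_z`) to a UNIT function**: every function over
`V` is `e(b • t_z) = b · e(t_z)` (★ `eq_smul_lineBundleGen`, surjectivity of `e`). [cite: GortzWedhorn2020, Section (11.9) (p. 374)] -/
theorem isUnit_hom_app_lineBundleGen (z : Y) (V : Y.Opens) (hV : V ≤ D.toUnitCocycle.U z) :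
    IsUnit (show Γ(Y, V) from e.hom.app V (D.toUnitCocycle.lineBundleGen z V hV)) := by
  -- `e⁻¹(1) = b • t_z`, so `1 = e(b • t_z) = b · e(t_z)`
  have hs := D.toUnitCocycle.eq_smul_lineBundleGen z V hV (e.inv.app V (1 : Γ(Y, V)))
  have h1 : (show Γ(Y, V) from e.hom.app V (e.inv.app V (1 : Γ(Y, V)))) = 1 := by
    rw [← CategoryTheory.comp_apply, ← Scheme.Modules.Hom.comp_app, e.inv_hom_id, Scheme.Modules.Hom.id_app]
    rfl
  rw [hs, Scheme.Modules.Hom.app_smul] at h1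
  exact IsUnit.of_mul_eq_one_right _ h1

/-- **`e(s) = s_z|_V · e(t_z)`** for a section `s` over `V ≤ U_z` (★ `eq_smul_lineBundleGen` + linearity of `e`).
[cite: GortzWedhorn2020, Section (11.9) (p. 374)] -/
theorem hom_app_eq_comp_mul (z : Y) (V : Y.Opens) (hV : V ≤ D.toUnitCocycle.U z)
    (s : Γ(Modules.lineBundle D.toUnitCocycle, V)) :
    (show Γ(Y, V) from e.hom.app V s) =
      secRes Y (le_inf le_rfl hV : V ≤ V ⊓ D.toUnitCocycle.U z) (D.toUnitCocycle.comp s z) *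
        (show Γ(Y, V) from e.hom.app V (D.toUnitCocycle.lineBundleGen z V hV)) := by
  conv_lhs => rw [D.toUnitCocycle.eq_smul_lineBundleGen z V hV s]
  rw [Scheme.Modules.Hom.app_smul]
  rfl

/-! ### §2 The rational function of the isomorphism -/

/-- **THE RATIONAL FUNCTION OF AN ISOMORPHISM `𝒪_Y(D) ≅ 𝒪_Y`**: there is `h ∈ K(Y)^×` with `e(s) = φ(s) · h` in `K(Y)` for every
section `s` of the glued line bundle over every non-empty open `W` (`φ = lineBundleRatFn`), and `h / f_i` a unit on each `U_i`
(so `D + div(h⁻¹)… ` is trivial: [GortzWedhorn2020] Prop. 11.21, `𝒪_Y(D) ≅ 𝒪_Y ⇔ D` principal).  `h` is `f_{i(ξ)} · e(t_ξ)` for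
the generator `t_ξ` in the chart of the generic point; chart independence is the cocycle relation `t_w = g_{zw} t_z`.
[cite: GortzWedhorn2020, Section (11.9) (p. 374) and Prop. 11.21 (p. 374)] -/
theorem exists_ratFn_of_iso_unit :
    ∃ h : Y.functionField, h ≠ 0 ∧
      (∀ {W : Y.Opens} (hW : genericPoint Y ∈ W) (s : Γ(Modules.lineBundle D.toUnitCocycle, W)),
        ofSection hW (show Γ(Y, W) from e.hom.app W s) = D.lineBundleRatFn hW s * h) ∧
      ∀ (i : D.ι) (x : Y), x ∈ D.U i → IsUnitAt x (h / D.f i) := by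
  -- the value of `e` on the generator of the chart of `z`, as a rational function, is `h_z := u_z`; set `h := f_{i(z)} u_z`
  -- read at any `z`; we show chart independence through the formula `e(s) = φ(s) · f_{i(z)} · u_z` on `W ∩ U_z`.
  have key : ∀ (z : Y) {W : Y.Opens} (hW : genericPoint Y ∈ W) (s : Γ(Modules.lineBundle D.toUnitCocycle, W)),
      ofSection hW (show Γ(Y, W) from e.hom.app W s) =
        D.lineBundleRatFn hW s * (D.f (D.chartIdx z) *
          ofSection (genericPoint_mem_of_mem (D.toUnitCocycle.mem z))
            (show Γ(Y, D.toUnitCocycle.U z) from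
              e.hom.app _ (D.toUnitCocycle.lineBundleGen z (D.toUnitCocycle.U z) le_rfl))) := by
    intro z W hW s
    -- restrict to `V := W ⊓ U_z`
    have hV : genericPoint Y ∈ W ⊓ D.toUnitCocycle.U z := D.genericPoint_mem_inf_toUnitCocycle_U hW z
    have hres : ofSection hW (show Γ(Y, W) from e.hom.app W s) =
        ofSection hV (show Γ(Y, W ⊓ D.toUnitCocycle.U z) from
          e.hom.app _ ((Modules.lineBundle D.toUnitCocycle).presheaf.map (homOfLE inf_le_left).op s)) := by
      rw [app_presheaf_map']
      exact (ofSection_map (homOfLE inf_le_left) hV _).symm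
    rw [hres, D.hom_app_eq_comp_mul e z _ inf_le_right, ofSection_mul', ofSection_secRes,
      D.ofSection_comp_eq hV, D.lineBundleRatFn_map (homOfLE inf_le_left) hV s]
    -- the generator over `W ⊓ U_z` is the restriction of the generator over `U_z`
    have hgen : D.toUnitCocycle.lineBundleGen z (W ⊓ D.toUnitCocycle.U z) inf_le_right =
        (Modules.lineBundle D.toUnitCocycle).presheaf.map (homOfLE inf_le_right).op
          (D.toUnitCocycle.lineBundleGen z (D.toUnitCocycle.U z) le_rfl) :=
      (D.toUnitCocycle.map_lineBundleGen z le_rfl (homOfLE inf_le_right)).symm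
    rw [hgen, app_presheaf_map']
    change _ * ofSection hV (Y.presheaf.map (homOfLE inf_le_right).op _) = _
    rw [ofSection_map]
    ring
  refine ⟨D.f (D.chartIdx (genericPoint Y)) *
      ofSection (genericPoint_mem_of_mem (D.toUnitCocycle.mem (genericPoint Y)))
        (show Γ(Y, D.toUnitCocycle.U (genericPoint Y)) from
          e.hom.app _ (D.toUnitCocycle.lineBundleGen (genericPoint Y) (D.toUnitCocycle.U (genericPoint Y)) le_rfl)),
    ?_, fun hW s => key (genericPoint Y) hW s, fun i x hx => ?_⟩
  · exact mul_ne_zero (D.f_ne_zero _)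
      (isUnitAt_ofSection_of_isUnit (D.isUnit_hom_app_lineBundleGen e _ _ le_rfl) (D.toUnitCocycle.mem _)).ne_zero
  · -- chart independence: the `key` formula at `z := x` and at `z := ξ` on the generator `t_x` over `U_x` gives
    -- `f_{i(ξ)} u_ξ = f_{i(x)} u_x`; and `u_x` is a unit at `x`
    have hUx : genericPoint Y ∈ D.toUnitCocycle.U x := genericPoint_mem_of_mem (D.toUnitCocycle.mem x)
    have k1 := key (genericPoint Y) hUx (D.toUnitCocycle.lineBundleGen x (D.toUnitCocycle.U x) le_rfl)
    have k2 := key x hUx (D.toUnitCocycle.lineBundleGen x (D.toUnitCocycle.U x) le_rfl)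
    -- `φ(t_x) = 1 / f_{i(x)} ≠ 0`
    have hφ : D.lineBundleRatFn hUx (D.toUnitCocycle.lineBundleGen x (D.toUnitCocycle.U x) le_rfl) =
        (D.f (D.chartIdx x))⁻¹ := by
      rw [D.lineBundleRatFn_eq hUx _ x, UnitCocycle.comp_lineBundleGen, D.toUnitCocycle.g_self, ofSection_one', one_div]
    have hφ0 : D.lineBundleRatFn hUx (D.toUnitCocycle.lineBundleGen x (D.toUnitCocycle.U x) le_rfl) ≠ 0 := by
      rw [hφ]; exact inv_ne_zero (D.f_ne_zero _)
    have heq := k1.symm.trans k2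
    rw [mul_right_inj' hφ0] at heq
    -- `h = f_{i(x)} u_x`; `h / f_i = (f_{i(x)} / f_i) · u_x`
    rw [heq, mul_div_right_comm]
    exact (D.isUnitAt_div (D.chartIdx x) i x (D.mem_U_chartIdx x) hx).mul
      (isUnitAt_ofSection_of_isUnit (D.isUnit_hom_app_lineBundleGen e x _ le_rfl) (D.toUnitCocycle.mem x))

end Literature.AlgebraicGeometry.Motives.CartierDivisor

end
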